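import Literature.NumberTheory.GaloisRepresentations.SuperellipticPicGaloisModule
import Mathlib.RingTheory.RootsOfUnity.AlgebraicallyClosed
import HarnessLib

/-!
# Places of `Ω(C_f)` fixed by a Frobenius twisted by a deck transformation (`C_f : y^p = f(x)`)

Topic `Literature/NumberTheory/GaloisRepresentations` (the superelliptic curves of
`SuperellipticFunctionField`).  Let `k = 𝔽_q` be a finite field with `p ∣ q - 1` (so `μ_p ⊆ k`), `Ω ⊇ k`
algebraically closed, `f ∈ k[X]` separable with `p ∤ deg f`, `φ ∈ Aut(Ω/k)` the `q`-Frobenius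
(`φ x = x^q`) acting on `Ω(C_f) = Ω(x)[y]/(y^p - f)` through the coefficients (hence on its places),
and `ξ : y ↦ ξ y` a deck transformation.  We count the places `Q` of `Ω(C_f)/Ω` with `φ(ξ Q) = Q`
(`card_fixedPlaces_frobenius_deck`):

  `#{Q : φ (ξ Q) = Q} = 1 + #{a ∈ k : f(a) = 0} + p · #{a ∈ k : f(a) ≠ 0, f(a)^{(q-1)/p} = ξ}`.

Indeed a fixed place lies above a `φ`-fixed point of `ℙ¹(Ω)`, i.e. above `∞` or above some `a ∈ k`
(`exists_eq_algebraMap_of_pow_card_eq`); above `∞` and above a root of `f` there is exactly one place,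
which is fixed (`p ∤ deg f`; total ramification); and the `p` places above a non-root `a ∈ k` carry the
labels `c`, `c^p = f(a)` (`y ≡ c`), permuted by `ξ` as `c ↦ ξ⁻¹ c` and by `φ` as `c ↦ c^q`, so that they
are all fixed when `c^{q-1} = f(a)^{(q-1)/p} = ξ` and none is fixed otherwise
(`smul_deck_smul_eq_self_iff_of_label`).  With the Lefschetz trace formula for the endomorphism
`φ ∘ ξ` of `C_f` (Milne, *Jacobian varieties*, Prop. 11.2) this count gives the traces of the twisted
Frobenii `φ ∘ ξ` on the Tate module of `J(C_f)`, which separate the eigenspaces of the deck group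
(the cubic character sums of a Picard curve, `PicardCurveGaloisRep`).  Everything is proved; no named
facts.

## References
* H. Stichtenoth, *Algebraic Function Fields and Codes*, 2nd ed. (2009), Lemma 3.5.2, Thm. 3.7.1,
  Prop. 3.7.3 (Kummer extensions: fibres and their labels). [Stichtenoth2009]
* J. S. Milne, *Jacobian varieties*, in: Arithmetic Geometry (Cornell–Silverman eds.), Springer (1986),
  §11, Prop. 11.2 (trace formula for an endomorphism of a curve). [Milne1986JacobianVarieties]
-/

noncomputable section

open Polynomial
open scoped Classical Pointwise

namespace Literature.NumberTheory.GaloisRepresentations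

open Literature.NumberTheory.DiophantineGeometry Literature.NumberTheory.DiophantineGeometry.AlgFunctionField

universe u v w

namespace SuperellipticFunctionField

variable {K : Type u} [Field K] {L : Type v} [Field L] [Algebra K L] {p : ℕ} {f : K[X]}
variable [Fact (Irreducible (superellipticPoly K L p f))] [hp : Fact p.Prime]
variable {G : Type w} [Group G] [MulSemiringAction G L] [SMulCommClass G K L]

/-! ### Labels on a non-root fibre under `σ ∘ ξ` -/

section Labels

variable [IsAlgClosed L]

omit hp [IsAlgClosed L] in
/-- **Labels are unique**: if `u ≡ c₁` and `u ≡ c₂ (mod Q)` for constants `c₁, c₂`, then `c₁ = c₂`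
(a nonzero constant is a unit at every place). [cite: Stichtenoth2009, Prop. 3.7.3] -/
theorem label_unique {Q : PlaceOver L (SuperellipticFunctionField K L p f)} {u : SuperellipticFunctionField K L p f}
    {c₁ c₂ : L} (h₁ : Q.valuation (u - algebraMap L _ c₁) < 1) (h₂ : Q.valuation (u - algebraMap L _ c₂) < 1) :
    c₁ = c₂ := by
  by_contra hne
  have h3 : Q.valuation ((u - algebraMap L _ c₂) - (u - algebraMap L _ c₁)) < 1 :=
    lt_of_le_of_lt (Valuation.map_sub _ _ _) (max_lt h₂ h₁)
  rw [sub_sub_sub_cancel_left, ← map_sub, PlaceOver.valuation_algebraMap_eq_one _ (sub_ne_zero.2 hne)] at h3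
  exact lt_irrefl _ h3

omit hp [IsAlgClosed L] in
/-- The label of `σ Q` is `σ c` (`σ` an automorphism of the constants, `σ y = y`). [folklore] -/
theorem valuation_smul_genY_sub_lt_one (σ : G) {Q : PlaceOver L (SuperellipticFunctionField K L p f)} {c : L}
    (hlab : Q.valuation (genY K L p f - algebraMap L _ c) < 1) :
    (σ • Q).valuation (genY K L p f - algebraMap L _ (σ • c)) < 1 := by
  have h := (valuation_smul_smul_lt_one_iff σ Q (genY K L p f - algebraMap L _ c)).2 hlab
  rwa [smul_sub, smul_genY, smul_algebraMap_superelliptic] at h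

/-- **Fixed places above a non-root, by labels.**  Let `Q` lie above a non-root `β` fixed by `σ`, with
label `c` (`y ≡ c (mod Q)`, `c^p = f(β) ≠ 0`), and let `ξ` be a deck transformation.  Then
`σ (ξ Q) = Q` iff `σ (ξ⁻¹ c) = c`: the place `σ (ξ Q)` lies above `β`, so it is a deck translate `ζ Q`
(transitivity on unramified fibres) with label `ζ⁻¹ c`, while its label computed through `ξ` and `σ` is
`σ (ξ⁻¹ c)`; labels are unique and determine `ζ`. [cite: Stichtenoth2009, Thm. 3.7.1] -/
theorem smul_deck_smul_eq_self_iff_of_label {ζ₀ : L} (hζ₀ : IsPrimitiveRoot ζ₀ p) (σ : G)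
    (ξ : CyclicCoverDeck L p) {β : L} (hβ : (f.map (algebraMap K L)).eval β ≠ 0) (hσβ : σ • β = β)
    {Q : PlaceOver L (SuperellipticFunctionField K L p f)} (hQ : Q.restrict (K := L) (F := RatFunc L) = placeXSubC β)
    {c : L} (hc : c ≠ 0) (hlab : Q.valuation (genY K L p f - algebraMap L _ c) < 1) :
    σ • (ξ • Q) = Q ↔ σ • (ξ.val⁻¹ * c) = c := by
  -- the label of `σ (ξ Q)` is `σ (ξ⁻¹ c)`
  have hlab' : (σ • (ξ • Q)).valuation (genY K L p f - algebraMap L _ (σ • (ξ.val⁻¹ * c))) < 1 :=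
    valuation_smul_genY_sub_lt_one σ (valuation_deck_smul_sub_lt_one deck_smul_genY hlab ξ)
  constructor
  · intro h
    rw [h] at hlab'
    exact label_unique hlab' hlab
  · intro h
    rw [h] at hlab'
    -- `σ (ξ Q)` lies above `β`, hence is a deck translate `ζ Q`, of label `ζ⁻¹ c`
    have hres : (σ • (ξ • Q)).restrict (K := L) (F := RatFunc L) = placeXSubC β := by
      rw [restrict_smul_of_restrict_eq_placeXSubC σ (by rw [restrict_deck_smul, hQ]), hσβ]
    obtain ⟨ζ, hζ⟩ := exists_deck_smul_eq_of_eval_ne_zero hζ₀ hβ hQ hres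
    have hlabζ : (ζ • Q).valuation (genY K L p f - algebraMap L _ (ζ.val⁻¹ * c)) < 1 :=
      valuation_deck_smul_sub_lt_one deck_smul_genY hlab ζ
    rw [hζ] at hlabζ
    have heq : ζ.val⁻¹ * c = c := label_unique hlabζ hlab'
    have hval : ζ.val = 1 := by
      have h4 : ζ.val⁻¹ = 1 := mul_right_cancel₀ hc (heq.trans (one_mul c).symm)
      rw [← inv_inv ζ.val, h4, inv_one]
    have hζ1 : ζ = 1 := CyclicCoverDeck.val_injective (by rw [hval, CyclicCoverDeck.val_one])
    rw [← hζ, hζ1, one_smul]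

end Labels

/-! ### The count over a finite field -/

section FiniteField

variable {k : Type u} [Field k] [Fintype k] {Ω : Type v} [Field Ω] [Algebra k Ω] [IsAlgClosed Ω]
variable {p : ℕ} [hp : Fact p.Prime] {f : k[X]} [Fact (Irreducible (superellipticPoly k Ω p f))]

omit hp [Fact (Irreducible (superellipticPoly k Ω p f))] [IsAlgClosed Ω] in
/-- **The fixed points of `x ↦ x^q` in `Ω ⊇ 𝔽_q` are `𝔽_q`**: both the image of `𝔽_q` and the root set of
`X^q - X` have `q` elements. [folklore] -/
theorem exists_eq_algebraMap_of_pow_card_eq {b : Ω} (hb : b ^ Fintype.card k = b) : ∃ a : k, algebraMap k Ω a = b := by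
  classical
  set q := Fintype.card k with hq
  have hq1 : 1 < q := Fintype.one_lt_card
  set P : Polynomial Ω := X ^ q - X with hP
  have hP0 : P ≠ 0 := FiniteField.X_pow_card_sub_X_ne_zero Ω hq1
  have hdeg : P.natDegree = q := FiniteField.X_pow_card_sub_X_natDegree_eq Ω hq1
  have hmem : ∀ x : Ω, x ∈ P.roots.toFinset ↔ x ^ q = x := fun x => by
    rw [Multiset.mem_toFinset, mem_roots hP0, IsRoot, hP, eval_sub, eval_pow, eval_X, sub_eq_zero]
  have hsub : Finset.univ.image (algebraMap k Ω) ⊆ P.roots.toFinset := by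
    intro x hx
    obtain ⟨a, -, rfl⟩ := Finset.mem_image.1 hx
    rw [hmem, ← map_pow, FiniteField.pow_card]
  have hcard : (Finset.univ.image (algebraMap k Ω)).card = q := by
    rw [Finset.card_image_of_injective _ (algebraMap k Ω).injective, Finset.card_univ]
  have hle : P.roots.toFinset.card ≤ q := (Multiset.toFinset_card_le _).trans (hdeg ▸ card_roots' P)
  have heq : Finset.univ.image (algebraMap k Ω) = P.roots.toFinset :=
    Finset.eq_of_subset_of_card_le hsub (by rw [hcard]; exact hle)
  have hbmem : b ∈ P.roots.toFinset := (hmem b).2 hb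
  rw [← heq] at hbmem
  obtain ⟨a, -, ha⟩ := Finset.mem_image.1 hbmem
  exact ⟨a, ha⟩

omit [Fact (Irreducible (superellipticPoly k Ω p f))] [IsAlgClosed Ω] [Fintype k] in
/-- `f_Ω(a) = f(a)` for `a ∈ k`. [folklore] -/
theorem eval_map_algebraMap_apply (a : k) : (f.map (algebraMap k Ω)).eval (algebraMap k Ω a) = algebraMap k Ω (f.eval a) := by
  rw [eval_map, eval₂_hom]

omit [Fact (Irreducible (superellipticPoly k Ω p f))] [IsAlgClosed Ω] [Algebra k Ω] hp in
/-- A `p`-th root of unity of `Ω` is fixed by the `q`-th power map when `p ∣ q - 1`. [folklore] -/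
theorem val_pow_card_eq (hpq : p ∣ Fintype.card k - 1) (ξ : CyclicCoverDeck Ω p) : ξ.val ^ Fintype.card k = ξ.val := by
  obtain ⟨t, ht⟩ := hpq
  have hq1 : 1 ≤ Fintype.card k := Fintype.card_pos
  conv_lhs => rw [← Nat.sub_add_cancel hq1, ht, pow_succ, pow_mul, CyclicCoverDeck.val_pow, one_pow, one_mul]

variable (φ : Ω ≃ₐ[k] Ω)

omit [Fintype k] in
/-- The unique place above `∞` is fixed by `φ ∘ ξ` (`p ∤ deg f`). [folklore] -/
theorem smul_deck_smul_inftyPlace (hndvd : ¬ p ∣ f.natDegree) (ξ : CyclicCoverDeck Ω p) :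
    φ • (ξ • inftyPlace k Ω p f) = inftyPlace k Ω p f := by
  rw [deck_smul_inftyPlace hndvd, smul_inftyPlace hndvd]

omit [Fintype k] [IsAlgClosed Ω] in
/-- The unique place above a root `a ∈ k` of `f` is fixed by `φ ∘ ξ`. [folklore] -/
theorem smul_deck_smul_rootPlace (hsep : f.Separable) {a : k} (ha : f.eval a = 0) (ξ : CyclicCoverDeck Ω p) :
    φ • (ξ • rootPlace k Ω p f (algebraMap k Ω a)) = rootPlace k Ω p f (algebraMap k Ω a) := by
  have hroot : (f.map (algebraMap k Ω)).IsRoot (algebraMap k Ω a) := by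
    rw [IsRoot, eval_map_algebraMap_apply, ha, map_zero]
  rw [deck_smul_rootPlace hsep hroot, smul_rootPlace hsep φ hroot, AlgEquiv.smul_def, AlgEquiv.commutes]

/-- **Fixed places above a non-root `a ∈ k`**: a place `Q` above `a`, `f(a) ≠ 0`, is fixed by `φ ∘ ξ`
(`φ x = x^q`, `p ∣ q - 1`) iff `f(a)^{(q-1)/p} = ξ` — independently of `Q`: its label `c` (`c^p = f(a)`)
must satisfy `ξ⁻¹ c^q = c`, i.e. `c^{q-1} = ξ`. [cite: Stichtenoth2009, Thm. 3.7.1] -/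
theorem smul_deck_smul_eq_self_iff_of_eval_ne_zero {ζ₀ : Ω} (hζ₀ : IsPrimitiveRoot ζ₀ p)
    (hφ : ∀ x : Ω, φ x = x ^ Fintype.card k) (hpq : p ∣ Fintype.card k - 1) (ξ : CyclicCoverDeck Ω p)
    {a : k} (ha : f.eval a ≠ 0) {Q : PlaceOver Ω (SuperellipticFunctionField k Ω p f)}
    (hQ : Q.restrict (K := Ω) (F := RatFunc Ω) = placeXSubC (algebraMap k Ω a)) :
    φ • (ξ • Q) = Q ↔ algebraMap k Ω (f.eval a) ^ ((Fintype.card k - 1) / p) = ξ.val := by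
  set q := Fintype.card k with hq
  have hq1 : 1 ≤ q := Fintype.card_pos
  have hβ : (f.map (algebraMap k Ω)).eval (algebraMap k Ω a) ≠ 0 := by
    rwa [eval_map_algebraMap_apply, _root_.map_ne_zero]
  obtain ⟨huQ, hlt⟩ := genY_mem_and_valuation_lt_one_of_eval_ne_zero hβ hQ
  obtain ⟨c, hcp, hlab⟩ := exists_label hζ₀ huQ hlt
  rw [eval_map_algebraMap_apply] at hcp
  have hc0 : c ≠ 0 := by
    rintro rfl
    rw [zero_pow hp.out.ne_zero] at hcp
    exact ((_root_.map_ne_zero (algebraMap k Ω)).2 ha) hcp.symm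
  have hσβ : φ • algebraMap k Ω a = algebraMap k Ω a := by rw [AlgEquiv.smul_def, AlgEquiv.commutes]
  rw [smul_deck_smul_eq_self_iff_of_label hζ₀ φ ξ hβ hσβ hQ hc0 hlab, AlgEquiv.smul_def, hφ, mul_pow, inv_pow,
    val_pow_card_eq hpq, inv_mul_eq_iff_eq_mul₀ (CyclicCoverDeck.val_ne_zero ξ)]
  have hcq : c ^ q = c ^ (q - 1) * c := by
    conv_lhs => rw [← Nat.sub_add_cancel hq1, pow_succ]
  have hcpow : c ^ (q - 1) = algebraMap k Ω (f.eval a) ^ ((q - 1) / p) := by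
    rw [← hcp, ← pow_mul, Nat.mul_div_cancel' hpq]
  rw [hcq, mul_left_inj' hc0, hcpow, eq_comm]

/-- **A place fixed by `φ ∘ ξ` lies above `∞` or above a point of `ℙ¹(k)`**: its image in `ℙ¹(Ω)` is
fixed by `φ` (the deck group acts fibrewise), and the fixed points of `x ↦ x^q` are `k ∪ {∞}`.
[cite: Stichtenoth2009, Lemma 3.5.2] -/
theorem eq_inftyPlace_or_exists_restrict_eq_of_smul_deck_smul_eq (hφ : ∀ x : Ω, φ x = x ^ Fintype.card k)
    (hndvd : ¬ p ∣ f.natDegree) (ξ : CyclicCoverDeck Ω p) {Q : PlaceOver Ω (SuperellipticFunctionField k Ω p f)}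
    (hfix : φ • (ξ • Q) = Q) :
    Q = inftyPlace k Ω p f ∨ ∃ a : k, Q.restrict (K := Ω) (F := RatFunc Ω) = placeXSubC (algebraMap k Ω a) := by
  rcases eq_ratFuncInftyPlace_or_exists_eq_placeXSubC Ω (Q.restrict (K := Ω) (F := RatFunc Ω)) with h | ⟨b, hb⟩
  · exact Or.inl (eq_inftyPlace_of_restrict_eq hndvd h)
  · right
    have h1 : (φ • (ξ • Q)).restrict (K := Ω) (F := RatFunc Ω) = placeXSubC (φ • b) :=
      restrict_smul_of_restrict_eq_placeXSubC φ (by rw [restrict_deck_smul, hb])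
    rw [hfix, hb] at h1
    have hφb : φ b = b := by rw [← AlgEquiv.smul_def]; exact (placeXSubC_injective h1).symm
    rw [hφ] at hφb
    obtain ⟨a, ha⟩ := exists_eq_algebraMap_of_pow_card_eq hφb
    exact ⟨a, by rw [ha, hb]⟩

/-- **The number of places of `Ω(C_f)` fixed by a Frobenius twisted by a deck transformation.**
Let `k = 𝔽_q` with `p ∣ q - 1` and `p ≠ 0` in `k`, `Ω ⊇ k` algebraically closed, `f ∈ k[X]` separable
with `p ∤ deg f`, `φ ∈ Aut(Ω/k)` with `φ x = x^q`, and `ξ` a deck transformation of `C_f : y^p = f(x)`.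
Then `#{Q : φ (ξ Q) = Q} = 1 + #{a ∈ k : f(a) = 0} + p · #{a ∈ k : f(a) ≠ 0, f(a)^{(q-1)/p} = ξ}`
(the place above `∞`, the places above the `k`-rational roots, and the full fibres above the non-roots
`a ∈ k` with `f(a)^{(q-1)/p} = ξ`). [cite: Stichtenoth2009, Thm. 3.7.1] [cite: Milne1986JacobianVarieties, §11] -/
theorem card_fixedPlaces_frobenius_deck (hφ : ∀ x : Ω, φ x = x ^ Fintype.card k) (hpk : (p : k) ≠ 0)
    (hsep : f.Separable) (hndvd : ¬ p ∣ f.natDegree) (hpq : p ∣ Fintype.card k - 1) (ξ : CyclicCoverDeck Ω p) :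
    Nat.card {Q : PlaceOver Ω (SuperellipticFunctionField k Ω p f) // φ • (ξ • Q) = Q} =
      1 + (Finset.univ.filter fun a : k => f.eval a = 0).card +
        p * (Finset.univ.filter fun a : k => f.eval a ≠ 0 ∧
          algebraMap k Ω (f.eval a) ^ ((Fintype.card k - 1) / p) = ξ.val).card := by
  classical
  haveI : NeZero ((p : ℕ) : Ω) := ⟨by rwa [Ne, ← map_natCast (algebraMap k Ω), map_eq_zero]⟩
  obtain ⟨ζ₀, hζ₀⟩ := HasEnoughRootsOfUnity.exists_primitiveRoot Ω p
  set ι := algebraMap k Ω with hι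
  -- the three pieces
  set Tinf : Finset (PlaceOver Ω (SuperellipticFunctionField k Ω p f)) := {inftyPlace k Ω p f} with hTinf
  set R : Finset k := Finset.univ.filter fun a : k => f.eval a = 0 with hR
  set Troot : Finset (PlaceOver Ω (SuperellipticFunctionField k Ω p f)) := R.image fun a => rootPlace k Ω p f (ι a)
    with hTroot
  set A : Finset k := Finset.univ.filter fun a : k => f.eval a ≠ 0 ∧ ι (f.eval a) ^ ((Fintype.card k - 1) / p) = ξ.val
    with hA
  set fib : k → Finset (PlaceOver Ω (SuperellipticFunctionField k Ω p f)) := fun a =>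
    ((placeXSubC (ι a)).finite_setOf_restrict_eq (F' := SuperellipticFunctionField k Ω p f)).toFinset with hfib
  have hmem_fib : ∀ (a : k) (Q : PlaceOver Ω (SuperellipticFunctionField k Ω p f)),
      Q ∈ fib a ↔ Q.restrict (K := Ω) (F := RatFunc Ω) = placeXSubC (ι a) := fun a Q =>
    (placeXSubC (ι a)).mem_toFinset_restrict_eq_iff Q
  have hβ : ∀ {a : k}, f.eval a ≠ 0 → (f.map (algebraMap k Ω)).eval (ι a) ≠ 0 := fun ha => by
    rwa [eval_map_algebraMap_apply, _root_.map_ne_zero]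
  have hroot : ∀ {a : k}, f.eval a = 0 → (f.map (algebraMap k Ω)).IsRoot (ι a) := fun ha => by
    rw [IsRoot, eval_map_algebraMap_apply, ha, map_zero]
  -- membership
  set T := Tinf ∪ Troot ∪ A.biUnion fib with hT
  have key : ∀ Q, Q ∈ T ↔ φ • (ξ • Q) = Q := by
    intro Q
    constructor
    · intro hQ
      rcases Finset.mem_union.1 hQ with hQ | hQ
      · rcases Finset.mem_union.1 hQ with hQ | hQ
        · rw [Finset.mem_singleton.1 hQ]
          exact smul_deck_smul_inftyPlace φ hndvd ξ
        · obtain ⟨a, ha, rfl⟩ := Finset.mem_image.1 hQ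
          exact smul_deck_smul_rootPlace φ hsep (Finset.mem_filter.1 ha).2 ξ
      · obtain ⟨a, ha, hQa⟩ := Finset.mem_biUnion.1 hQ
        obtain ⟨ha0, hcond⟩ := (Finset.mem_filter.1 ha).2
        exact (smul_deck_smul_eq_self_iff_of_eval_ne_zero φ hζ₀ hφ hpq ξ ha0 ((hmem_fib a Q).1 hQa)).2 hcond
    · intro hfix
      rcases eq_inftyPlace_or_exists_restrict_eq_of_smul_deck_smul_eq φ hφ hndvd ξ hfix with rfl | ⟨a, ha⟩
      · exact Finset.mem_union_left _ (Finset.mem_union_left _ (Finset.mem_singleton_self _))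
      · by_cases ha0 : f.eval a = 0
        · refine Finset.mem_union_left _ (Finset.mem_union_right _ (Finset.mem_image.2 ⟨a, ?_, ?_⟩))
          · exact Finset.mem_filter.2 ⟨Finset.mem_univ _, ha0⟩
          · exact (eq_rootPlace_of_restrict_eq hsep (hroot ha0) ha).symm
        · have hcond := (smul_deck_smul_eq_self_iff_of_eval_ne_zero φ hζ₀ hφ hpq ξ ha0 ha).1 hfix
          exact Finset.mem_union_right _ (Finset.mem_biUnion.2 ⟨a, Finset.mem_filter.2 ⟨Finset.mem_univ _, ha0, hcond⟩,
            (hmem_fib a Q).2 ha⟩)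
  -- `Nat.card = T.card`
  have hcardT : Nat.card {Q : PlaceOver Ω (SuperellipticFunctionField k Ω p f) // φ • (ξ • Q) = Q} = T.card := by
    rw [Nat.card_congr (Equiv.subtypeEquivRight fun Q => (key Q).symm), Nat.card_eq_fintype_card, Fintype.card_coe]
  rw [hcardT]
  -- disjointness
  have hdisj1 : Disjoint Tinf Troot := by
    rw [Finset.disjoint_singleton_left]
    intro h
    obtain ⟨a, -, ha⟩ := Finset.mem_image.1 h
    exact inftyPlace_ne_rootPlace (ι a) ha.symm
  have hinf_notmem : ∀ a : k, inftyPlace k Ω p f ∉ fib a := fun a h => by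
    have h1 := (hmem_fib a _).1 h
    rw [restrict_inftyPlace] at h1
    exact placeXSubC_ne_ratFuncInftyPlace (ι a) h1.symm
  have hdisj2 : Disjoint (Tinf ∪ Troot) (A.biUnion fib) := by
    rw [Finset.disjoint_left]
    intro Q hQ hQ'
    obtain ⟨a, ha, hQa⟩ := Finset.mem_biUnion.1 hQ'
    rcases Finset.mem_union.1 hQ with hQ | hQ
    · rw [Finset.mem_singleton.1 hQ] at hQa
      exact hinf_notmem a hQa
    · obtain ⟨a', ha', rfl⟩ := Finset.mem_image.1 hQ
      have h1 := (hmem_fib a _).1 hQa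
      rw [restrict_rootPlace] at h1
      have haa : a' = a := (algebraMap k Ω).injective (placeXSubC_injective h1)
      exact (Finset.mem_filter.1 ha).2.1 (haa ▸ (Finset.mem_filter.1 ha').2)
  have hdisj3 : (A : Set k).PairwiseDisjoint fib := by
    intro a _ a' _ hne
    rw [Function.onFun, Finset.disjoint_left]
    intro Q hQ hQ'
    exact hne ((algebraMap k Ω).injective (placeXSubC_injective (((hmem_fib a Q).1 hQ).symm.trans ((hmem_fib a' Q).1 hQ'))))
  rw [Finset.card_union_of_disjoint hdisj2, Finset.card_union_of_disjoint hdisj1, Finset.card_singleton,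
    Finset.card_biUnion hdisj3, Finset.card_image_of_injective _ fun a a' h =>
      (algebraMap k Ω).injective (placeXSubC_injective (by
        rw [← restrict_rootPlace (K := k) (L := Ω) (p := p) (f := f) (ι a), ← restrict_rootPlace (K := k) (L := Ω) (p := p) (f := f) (ι a')]
        exact congrArg _ h)),
    Finset.sum_congr rfl fun a ha => card_fibre_of_eval_ne_zero hζ₀ (hβ (Finset.mem_filter.1 ha).2.1),
    Finset.sum_const, smul_eq_mul, mul_comm]

end FiniteField

end SuperellipticFunctionField

end Literature.NumberTheory.GaloisRepresentations

end
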